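import Summits.CriticalPhenomena.CardyFormulaZ2.Theses.CardyCapacityWard

/-!
# Birth skeleton (BC3) for the crux `FlatMarkedCovariance` — stmt-CriticalPhenomena-4619

Route `CardyCapacityWard` (route-CriticalPhenomena-CardyCapacityWard), sub-problem `CardyFormulaZ2`,
crux = the route's TARGET (rank 0, auto-crux):

  `FlatMarkedCovariance : ∃ f : ℝ → ℝ, ContinuousOn f (Ioo 0 1) ∧ ∀ R : ConformalRectangle,
      R.carrier ⊆ ℍ → (∀ i, ∃ ρ > 0, ball (R.pt i) ρ ∩ ℍ ⊆ R.carrier) →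
      R.HasCrossingLimit (bondDomainCrossingProb R) f`

— ONE continuous `f` on `(0,1)` gives the `δ → 0⁺` limit `f(η)` of the bond-`ℤ²` crossing
probabilities of every FLAT-MARKED conformal rectangle (carrier in `ℍ`, an upper half-ball around
each of the four marks inside the carrier, so the marks are real and `∂R` is the real line near them).

## The line (the route's own second layer `JordanBridge : HydroUniformizer → HullCovariance →
FlatMarkedCovariance`, with the bridge cut into its two genuine halves and the limit bookkeeping PROVED)

* `stub_hydroUniformizer` — the route item `HydroUniformizer` (stmt-CriticalPhenomena-14541, BY NAME):
  every fat rectilinear hull `L` has a hydrodynamically normalised uniformizer `ψ : ℍ → ℍ ∖ L` with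
  continuous boundary extension, unique on `ℍ` (Riemann mapping + Schwarz reflection +
  Carathéodory–Torhorst; Lawler 2005 Prop. 3.36, Pommerenke 1992 Thm 2.1). Classical; size L
  (formalisation: no Riemann mapping theorem in Mathlib).
* `stub_hullCovariance` — the route item `HullCovariance` (stmt-CriticalPhenomena-14540, BY NAME): one
  `f`, continuous on `(0,1)`, such that for every fat rectilinear hull `L`, hydrodynamic uniformizer
  `ψ` and image marks `y₀<y₁<y₂<y₃`, the CRUDE crossing probability of `ℍ ∖ L` between the transported
  arcs `ψ[y₀,y₁]`, `ψ[y₂,y₃]` tends to `f (crossRatio y)`. This is the conformal-invariance content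
  (reached inside the route by `WardIntegration` from `FaceWard` + `HalfPlaneMobius`); open-problem
  grade; the HARDEST stub.
* `stub_outerSandwich` — UPPER half of the Jordan bridge (geometry + classical complex analysis, size L):
  given `HydroUniformizer`, for every flat-marked `R`, uniformizing datum `(φ, x)` and `ε > 0` there is
  an admissible hull datum `(m, L, ψ, y)` (fat rectilinear `L`, hydrodynamic `ψ`, `StrictMono y`) with
  `|crossRatio y − crossRatio x| < ε` whose crude transported-arc crossing probability dominates
  `bondDomainCrossingProb R δ − ε` for all small `δ`. Construction: marked arcs pushed INTO `R` by `s`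
  (rectilinear staircases from `a − s` to `b + s` and from `c − s` to `d + s`, junctions on the flat
  real boundary), free arcs pushed OUT by `s`, the bounded approximant joined to `ℍ ∖ (big box)` by a
  thin tube through the roof (so that `L` is bounded and `ℍ ∖ L` simply connected); every
  `discreteCrossing` of `R_δ` between the discrete arcs CONTAINS a crude crossing of `ℍ ∖ L` between the
  staircases (last exit from the `(ab)`-pocket → first entry into the `(cd)`-pocket: pure path surgery,
  no probability lost); `crossRatio y → crossRatio x` as `s → 0` by Carathéodory kernel convergence /
  extremal length (the tube of width `w → 0` carries vanishing modulus).
* `stub_innerSandwich` — LOWER half of the Jordan bridge (the same geometry with the roles exchanged —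
  marked arcs pushed OUT to real segments `[a+s, b−s]`, `[c+s, d−s]`, free arcs pushed IN — PLUS the
  percolation estimates, size L–XL): a crude crossing of `ℍ ∖ L` that does not use the tube (two
  disjoint long crossings of a `w × ℓ` tube: BK/RSW cost `e^{−cℓ/w}`, uniformly in `δ ≤ δ(w)`) is an
  open path of the mesh graph of `R` inside its largest component (vertex counts follow areas for
  `δ` small), and its start/end within `2δ` of the real marked segments are upgraded to discrete-arc
  vertices of `R_δ` at a cost `→ 0` (RSW near-miss at a flat boundary: a macroscopic cluster reaching
  height `2δ` above `[a+s,b−s]` touches the boundary row except on a boundary 3-arm event).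

Composition `FlatMarkedCovariance_of` (REAL proof, ~40 lines, no sorry): take `f` from
`stub_hullCovariance`; for a flat-marked `R` and datum `(φ, x)`, `η = crossRatio x ∈ (0,1)`
(`crossRatio_mem_Ioo_of_isUniformizing`), so `f` is continuous AT `η`; given `e > 0` choose `τ` from
continuity, apply both sandwiches with `ε₁ = min τ (e/3)`, read the limits `f (crossRatio y±)` of the
two hull data from `stub_hullCovariance`, and squeeze: eventually (in `𝓝[>] 0`)
`|bondDomainCrossingProb R δ − f η| < e`.

Device (as in `Cruxes/BoxFamilyToCardy/Lines/birth.lean`): each stub is `theorem stub_<name> : <sig> :=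
by sorry`; the reducible aliases `Registered.stub_<name> : Prop := type_of% stub_<name>` key the stub
statements BY NAME as the hypotheses of the composition (skeleton audit `#h21_check_skeleton`), and
`FlatMarkedCovariance_proof` certifies that the four stubs inhabit them. Sorries: exactly the four
`stub_*`. No `Disproof.lean` / dead lines exist for this crux (`ledger crux ls stmt-CriticalPhenomena-4619`:
no workfiles, 2026-08-17); negatives index (`ledger negatives --problem CriticalPhenomena`): no entry
mentions `FlatMarkedCovariance`, `HullCovariance` or route `CardyCapacityWard` — nothing refuted is assumed.

BC3 probes (registrar's folder `bc/stub_<name>_probe.lean`, `bc/stub_<name>_split_probe.lean`; files that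
do NOT import this skeleton, so no sorried theorem is in scope; `maxHeartbeats 400000` each): for every
stub, `stub → FlatMarkedCovariance` and `stub → _root_.CardyFormulaZ2`, by name and with hypothesis and
target unfolded, via `first | exact? | simpa | simpa [..] | (unfold ..; simpa) | aesop` — 16/16 FAIL
(`stub_hydroUniformizer`, `stub_hullCovariance`: "unsolved goals … aesop: failed to prove the goal after
exhaustive search" 6/8, heartbeat exhaustion at `whnf` 2/8; the two sandwich stubs: heartbeat
exhaustion inside the battery 8/8, so each tactic was re-run ALONE: `exact?` "could not close the
goal", `simpa` "assumption failed", `aesop` "failed … after exhaustive search", `tauto` failed —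
16/16 FAIL). No stub cheaply gives the crux or the summit.
-/

noncomputable section

namespace Summit.CriticalPhenomena.CardyFormulaZ2.Cruxes.FlatMarkedCovariance.Birth

open scoped Topology
open Set Filter MeasureTheory
open UpperHalfPlane (upperHalfPlaneSet)
open Literature.Probability.RandomPlanarGeometry
open Literature.Probability.Percolation (bondDomainCrossingProb bondPercolation half embDomainCrossing)
open Literature.Probability.LatticeModels (zdGraph Site.toComplex)
open Summit.CriticalPhenomena.CardyFormulaZ2.Theses.CardyCapacityWard (FlatMarkedCovariance
  HullCovariance HydroUniformizer)

/-! ### The four registered stubs (the ONLY `sorry`s of this file) -/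

/-- **Stub 1 (classical input; the route item `HydroUniformizer`, stmt-CriticalPhenomena-14541, by
name).** Hydrodynamically normalised uniformizers `ψ : ℍ → ℍ ∖ L` of fat rectilinear hulls exist, have
a continuous boundary extension, and are unique on `ℍ` (Lawler 2005 Prop. 3.36; Pommerenke 1992
Thm 2.1). Size L (formalisation). -/
theorem stub_hydroUniformizer : HydroUniformizer := by
  sorry

/-- **Stub 2 (OPEN — the conformal-invariance content; the route item `HullCovariance`,
stmt-CriticalPhenomena-14540, by name; HARDEST).** One `f`, continuous on `(0,1)`, gives the limit
`f (crossRatio y)` of the crude bond-`ℤ²` crossing probability of `ℍ ∖ L` between the transported arcs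
`ψ[y₀,y₁]`, `ψ[y₂,y₃]` for every fat rectilinear hull `L`, hydrodynamic uniformizer `ψ` and marks
`y₀<y₁<y₂<y₃` (reached in the route by `WardIntegration` from `FaceWard` + `HalfPlaneMobius`). -/
theorem stub_hullCovariance : HullCovariance := by
  sorry

/-- **Stub 3 (UPPER half of the Jordan bridge; geometry + classical complex analysis, size L).**
Given `HydroUniformizer`: for every flat-marked conformal rectangle `R`, uniformizing datum `(φ, x)`
and `ε > 0` there is an admissible hull datum `(m, L, ψ, y)` — `L` a fat rectilinear hull (bounded,
`closure (L ∩ ℍ) = L`, `ℍ ∖ L` simply connected, `≤ m` closed boxes, `closure (interior L) = L`), `ψ`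
a hydrodynamic uniformizer of `ℍ ∖ L`, `y` strictly increasing — with `|crossRatio y − crossRatio x| < ε`
and, for all small `δ`, `bondDomainCrossingProb R δ ≤ P_δ(ℍ ∖ L; ψ[y₀,y₁], ψ[y₂,y₃]) + ε`
(marked arcs pushed in, free arcs pushed out, thin tube to the outside of a box; every discrete
crossing of `R_δ` contains a crude crossing between the staircases; Carathéodory for the moduli). -/
theorem stub_outerSandwich :
    let P : Set ℂ → ℝ → Set ℂ → Set ℂ → ℝ := fun L δ A B ↦ (bondPercolation (zdGraph 2) half).real
      (embDomainCrossing Site.toComplex (upperHalfPlaneSet \ L) δ A B)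
    let IsHull : Set ℂ → Prop := fun A ↦ Bornology.IsBounded A ∧
      closure (A ∩ upperHalfPlaneSet) = A ∧ IsSimplyConnected (upperHalfPlaneSet \ A)
    let IsRect : ℕ → Set ℂ → Prop := fun m A ↦
      ∃ a b c d : Fin m → ℝ, A = ⋃ i, Complex.reProdIm (Set.Icc (a i) (b i)) (Set.Icc (c i) (d i))
    let IsHydro : (ℂ → ℂ) → Prop := fun g ↦
      Filter.Tendsto (fun w ↦ g w - w) (Filter.cocompact ℂ ⊓ Filter.principal upperHalfPlaneSet) (nhds 0)
    let Arc : (ℂ → ℂ) → ℝ → ℝ → Set ℂ := fun γ a b ↦ γ '' (Complex.ofReal '' Set.Icc a b)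
    HydroUniformizer →
    ∀ R : ConformalRectangle, R.carrier ⊆ upperHalfPlaneSet →
      (∀ i, ∃ ρ > 0, Metric.ball (R.pt i) ρ ∩ upperHalfPlaneSet ⊆ R.carrier) →
      ∀ (φ : ConformalEquiv upperHalfPlaneSet R.carrier) (x : Fin 4 → ℝ), R.IsUniformizing φ x →
      ∀ ε : ℝ, 0 < ε →
        ∃ (m : ℕ) (L : Set ℂ) (ψ : ConformalEquiv upperHalfPlaneSet (upperHalfPlaneSet \ L))
          (y : Fin 4 → ℝ), IsHull L ∧ IsRect m L ∧ closure (interior L) = L ∧ IsHydro ψ ∧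
          StrictMono y ∧ |crossRatio y - crossRatio x| < ε ∧
          ∃ δ₀ : ℝ, 0 < δ₀ ∧ ∀ δ ∈ Set.Ioo 0 δ₀,
            bondDomainCrossingProb R δ ≤
              P L δ (Arc ψ.boundaryExtension (y 0) (y 1)) (Arc ψ.boundaryExtension (y 2) (y 3)) + ε := by
  sorry

/-- **Stub 4 (LOWER half of the Jordan bridge; geometry + RSW, size L–XL).** Given `HydroUniformizer`:
for every flat-marked `R`, datum `(φ, x)` and `ε > 0` there is an admissible hull datum `(m, L, ψ, y)`
with `|crossRatio y − crossRatio x| < ε` and, for all small `δ`,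
`P_δ(ℍ ∖ L; ψ[y₀,y₁], ψ[y₂,y₃]) − ε ≤ bondDomainCrossingProb R δ` (marked arcs pushed OUT to real
segments `[a+s,b−s]`, `[c+s,d−s]`, free arcs pushed IN, tube to the outside of a box; a crude crossing
not using the tube — BK/RSW cost `e^{−cℓ/w}` — is a path of the largest mesh component of `R`, and its
ends within `2δ` of the real marked segments are upgraded to discrete-arc vertices except on a boundary
near-miss event of probability `→ 0`; Carathéodory for the moduli). -/
theorem stub_innerSandwich :
    let P : Set ℂ → ℝ → Set ℂ → Set ℂ → ℝ := fun L δ A B ↦ (bondPercolation (zdGraph 2) half).real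
      (embDomainCrossing Site.toComplex (upperHalfPlaneSet \ L) δ A B)
    let IsHull : Set ℂ → Prop := fun A ↦ Bornology.IsBounded A ∧
      closure (A ∩ upperHalfPlaneSet) = A ∧ IsSimplyConnected (upperHalfPlaneSet \ A)
    let IsRect : ℕ → Set ℂ → Prop := fun m A ↦
      ∃ a b c d : Fin m → ℝ, A = ⋃ i, Complex.reProdIm (Set.Icc (a i) (b i)) (Set.Icc (c i) (d i))
    let IsHydro : (ℂ → ℂ) → Prop := fun g ↦
      Filter.Tendsto (fun w ↦ g w - w) (Filter.cocompact ℂ ⊓ Filter.principal upperHalfPlaneSet) (nhds 0)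
    let Arc : (ℂ → ℂ) → ℝ → ℝ → Set ℂ := fun γ a b ↦ γ '' (Complex.ofReal '' Set.Icc a b)
    HydroUniformizer →
    ∀ R : ConformalRectangle, R.carrier ⊆ upperHalfPlaneSet →
      (∀ i, ∃ ρ > 0, Metric.ball (R.pt i) ρ ∩ upperHalfPlaneSet ⊆ R.carrier) →
      ∀ (φ : ConformalEquiv upperHalfPlaneSet R.carrier) (x : Fin 4 → ℝ), R.IsUniformizing φ x →
      ∀ ε : ℝ, 0 < ε →
        ∃ (m : ℕ) (L : Set ℂ) (ψ : ConformalEquiv upperHalfPlaneSet (upperHalfPlaneSet \ L))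
          (y : Fin 4 → ℝ), IsHull L ∧ IsRect m L ∧ closure (interior L) = L ∧ IsHydro ψ ∧
          StrictMono y ∧ |crossRatio y - crossRatio x| < ε ∧
          ∃ δ₀ : ℝ, 0 < δ₀ ∧ ∀ δ ∈ Set.Ioo 0 δ₀,
            P L δ (Arc ψ.boundaryExtension (y 0) (y 1)) (Arc ψ.boundaryExtension (y 2) (y 3)) - ε ≤
              bondDomainCrossingProb R δ := by
  sorry

/-! ### Name-keyed aliases of the four stub statements (the hypotheses of the composition)

The skeleton audit (`#h21_check_skeleton`, HarnessLib/Audit/Check.lean) admits as hypotheses of the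
composition exactly registered obligations and the declared stubs BY NAME; these reducible aliases key
each stub statement (`type_of%` the stub, so the text is not duplicated) by its stub name. -/
namespace Registered

/-- Alias of the statement of `stub_hydroUniformizer` (= the route item `HydroUniformizer`). -/
abbrev stub_hydroUniformizer : Prop := type_of% Birth.stub_hydroUniformizer

/-- Alias of the statement of `stub_hullCovariance` (= the route item `HullCovariance`). -/
abbrev stub_hullCovariance : Prop := type_of% Birth.stub_hullCovariance

/-- Alias of the statement of `stub_outerSandwich`. -/
abbrev stub_outerSandwich : Prop := type_of% Birth.stub_outerSandwich

/-- Alias of the statement of `stub_innerSandwich`. -/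
abbrev stub_innerSandwich : Prop := type_of% Birth.stub_innerSandwich

end Registered

/-- Consistency: each alias IS its stub statement — the stubs inhabit the aliases. -/
theorem registered_of_stubs :
    Registered.stub_hydroUniformizer ∧ Registered.stub_hullCovariance ∧
      Registered.stub_outerSandwich ∧ Registered.stub_innerSandwich :=
  ⟨stub_hydroUniformizer, stub_hullCovariance, stub_outerSandwich, stub_innerSandwich⟩

/-! ### Composition (sorry-free): the four stubs imply the crux BY NAME -/

/-- **`FlatMarkedCovariance` from the stubs (real proof).** `f` is the function of `HullCovariance`;
for a flat-marked `R` with datum `(φ, x)`, `η = crossRatio x ∈ (0,1)`, `f` is continuous at `η`;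
both sandwiches at tolerance `ε₁ = min τ (e/3)` (`τ` from continuity) produce hull data whose crude
crossing probabilities converge to `f (crossRatio y±)` with `|f (crossRatio y±) − f η| < e/3`, and the
squeeze gives `|bondDomainCrossingProb R δ − f η| < e` eventually in `𝓝[>] 0`. -/
theorem FlatMarkedCovariance_of (hU : Registered.stub_hydroUniformizer)
    (hH : Registered.stub_hullCovariance) (hO : Registered.stub_outerSandwich)
    (hI : Registered.stub_innerSandwich) : FlatMarkedCovariance := by
  dsimp only [Registered.stub_hydroUniformizer, Registered.stub_hullCovariance,
    Registered.stub_outerSandwich, Registered.stub_innerSandwich, HullCovariance] at hU hH hO hI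
  obtain ⟨f, hfc, hf⟩ := hH
  refine ⟨f, hfc, ?_⟩
  intro R hRH hflat φ x hφx
  have hη : crossRatio x ∈ Set.Ioo (0 : ℝ) 1 :=
    ConformalRectangle.crossRatio_mem_Ioo_of_isUniformizing hφx
  rw [Metric.tendsto_nhds]
  intro e he
  have he3 : 0 < e / 3 := by positivity
  -- continuity of `f` at the modulus `η`
  have hcont : ContinuousAt f (crossRatio x) := hfc.continuousAt (Ioo_mem_nhds hη.1 hη.2)
  obtain ⟨τ, hτ, hτf⟩ := Metric.continuousAt_iff.1 hcont (e / 3) he3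
  have hε₁ : 0 < min τ (e / 3) := lt_min hτ he3
  -- the two sandwiches at tolerance `ε₁ = min τ (e/3)`
  obtain ⟨m₁, L₁, ψ₁, y₁, hHull₁, hRect₁, hclo₁, hHyd₁, hy₁, hcr₁, δ₁, hδ₁, hup⟩ :=
    hO hU R hRH hflat φ x hφx (min τ (e / 3)) hε₁
  obtain ⟨m₂, L₂, ψ₂, y₂, hHull₂, hRect₂, hclo₂, hHyd₂, hy₂, hcr₂, δ₂, hδ₂, hlo⟩ :=
    hI hU R hRH hflat φ x hφx (min τ (e / 3)) hε₁
  -- the limits of the two hull-complement crossing probabilities (HullCovariance)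
  have hlim₁ := hf m₁ L₁ ψ₁ y₁ hHull₁ hRect₁ hclo₁ hHyd₁ hy₁
  have hlim₂ := hf m₂ L₂ ψ₂ y₂ hHull₂ hRect₂ hclo₂ hHyd₂ hy₂
  rw [Metric.tendsto_nhds] at hlim₁ hlim₂
  -- `|f (crossRatio yᵢ) - f η| < e/3`
  have hf₁ : dist (f (crossRatio y₁)) (f (crossRatio x)) < e / 3 :=
    hτf (by rw [Real.dist_eq]; exact lt_of_lt_of_le hcr₁ (min_le_left _ _))
  have hf₂ : dist (f (crossRatio y₂)) (f (crossRatio x)) < e / 3 :=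
    hτf (by rw [Real.dist_eq]; exact lt_of_lt_of_le hcr₂ (min_le_left _ _))
  rw [Real.dist_eq, abs_lt] at hf₁ hf₂
  have hmin : min τ (e / 3) ≤ e / 3 := min_le_right _ _
  -- squeeze, eventually in `𝓝[>] 0`
  filter_upwards [hlim₁ (e / 3) he3, hlim₂ (e / 3) he3, Ioo_mem_nhdsGT hδ₁, Ioo_mem_nhdsGT hδ₂]
    with δ h₁ h₂ hd₁ hd₂
  rw [Real.dist_eq, abs_lt] at h₁ h₂ ⊢
  have hu := hup δ hd₁
  have hl := hlo δ hd₂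
  constructor <;> linarith [h₁.1, h₁.2, h₂.1, h₂.2]

/-- **The crux BY NAME from the four stubs** (depends on `sorryAx` ONLY through the four `stub_*`;
certifies mechanically that the aliases ARE the stub statements). -/
theorem FlatMarkedCovariance_proof : FlatMarkedCovariance :=
  FlatMarkedCovariance_of stub_hydroUniformizer stub_hullCovariance stub_outerSandwich
    stub_innerSandwich

end Summit.CriticalPhenomena.CardyFormulaZ2.Cruxes.FlatMarkedCovariance.Birth

end
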